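import Summits.QuantumFields.BalabanUV.Beta.GAN24.WilsonFaceGradedIdentity

/-!
# `BalabanUV.Beta.GAN24.WilsonEdgeCurrentDiag` — binder row G-an2-4 ∕ (CONV-C), W-slot CT-W, the conservation law (C)∕(C)sym (hypothesis `hC` of
# `ThreeFaceRecClosed.exists_allScalesSeq_JsRowD1Pin_of_C_QD`; OWNER RULING R-gan24p1-g23-3 (ii)): **THE SAME-AXIS BIWEIGHTED CONTRACTION OF an3's CUBIC
# WILSON STENCIL VANISHES** — for ARBITRARY weights `p q : ℤ → ℝ` of the slot's `γ`-coordinate and of the first leg's `γ`-coordinate (the first leg taken ALONG the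
# slot direction `γ`), the `(inl γ, inl b)`-block summed over the slot and the first leg is `0` for every second-leg component `b` (generic `d`) — the companion of
# the sibling module `GAN24.WilsonEdgeCurrent` (`γ ≠ α`: the contraction is the edge current `−d*(p ⊗ q)`); together: a background along `γ` contracted with a
# leg along `α` sources the `(γ, α)`-edge current when `α ≠ γ` and NOTHING when `α = γ`

NOT IN PRINT; OUR BOOKKEEPING ([folklore] finite stencil algebra over an3's DEFINED tables `PlaquetteStencilData.wα ∕ wβ ∕ wm` read through leaf-15's register
`WilsonVertexSumZero` (`uv`, `wc`) and this lineage's `WilsonGradedBlockSums` §1 (family offsets ∕ entries) and `WilsonFaceGradedIdentity.sum_weighted_wilsonA` BY NAME;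
G-an2-4 formalisation swarm, leaf prover `b2b-balaban-gan24-formalise-leaf-04`, gen 64).  HONEST FRAMING (cell contract, verbatim): «discharging `BetaPertH` makes
Bałaban's UV stability UNCONDITIONAL — a real constructive-QFT result; it is NOT the continuum limit and NOT the Clay problem.»  HONEST DEPENDENCY (verbatim):
«continuum YM on T⁴ ⇐ BetaPertH ∧ nine spine estimates (0/9 proved); BetaPertH ⇐ (D1) ∧ (D4) ∧ CAP+tail; G-an2-4 gates asym, D1 and NE2/3/4.»

WHY (the located use; this lineage's note `HOME/b2b-balaban-gan24-formalise-leaf-04/g64/CSYM-D3-ANATOMY.md` §3 (c) and §7): in the zero mode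
`Z_X(μν;αβ) = m_αᵀ K3OfK_X[1_μ,1_ν] m_β` of ONE dressed second-order step the cubic × cubic Wilson EXCHANGE word `m_αᵀ X dM_μ X dM_ν X m_β` has the half-vertex
vector «background `f_μ` (exit-face profile, a function of the `μ`-coordinate) contracted with the response leg `X m_α` (a profile along `α`, a function of the
`α`-coordinate)»: for `μ ≠ α` it is the `(μ, α)`-edge current of `WilsonEdgeCurrent`; for `μ = α` it is the present contraction and VANISHES — so in the pattern
`(μα;μα)` only the `(μ↔ν)`-swapped exchange survives (kit j167153 ∕ j168341: `|tL[μ=α]| ≤ 8·10⁻¹⁶` against `|tL[μ≠α]| = 4·10⁻²`, D = 2, L = 3, 5).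

MECHANISM (generic `d`; no `decide`, no numeral case bash): `sum_weighted_wilsonA` turns the box double sum into `½((H1ᵈ) − (H2ᵈ))` with (H1ᵈ) `Σ_i p(−(wβ i)_γ)·
q((wα i)_γ − (wβ i)_γ)·wc γ i γ b` and (H2ᵈ) `Σ_i p(−(wα i)_γ)·q((wβ i)_γ − (wα i)_γ)·wc γ i b γ`; family by family: the CURRENT family gives
`[b = γ]·(p 0·q 1 − p(−1)·q(−1))` to (H1ᵈ) and its negative to (H2ᵈ); the LONGITUDINAL family gives `[b = γ]·2·(p(−1)·q(−1) − p 0·q 0)` to (H1ᵈ) and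
`[b = γ]·2·(p 0·q 1 − p 0·q 0)` to (H2ᵈ); SPIN and the three REMAINDER families give `0` to both; hence (H1ᵈ) = (H2ᵈ) `= [b = γ]·(p(−1)·q(−1) + p 0·q 1 − 2·p 0·q 0)`
and the antisymmetrisation is `0`.  In exact arithmetic every family table agrees at `d+1 = 2, 3, 4` (`g64/num/bilinear_fam.py` with `(μ, α) = (0, 0)`, DIAG only).

WHAT ([folklore]; 0 `def`, 0 cited facts, 0 `def … : Prop`, 0 sorry; generic `d`): §1 per-family lemmas `h1d_cur … h1d_fa`, `h2d_cur … h2d_fa`, the totals `h1d_total`,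
`h2d_total`; §2 **`sum_box1_biweighted_wilsonA_diag`** (slot at `0`) and **`sum_box1_biweighted_wilsonA_diag_at`** (slot translates of a fixed second leg `z`).  Asserts NO
value of Bałaban's tables beyond these finite identities of an3's defined stencil; discharges NOTHING of (C)sym ∕ (Q-D) ∕ (Q-D-rate) ∕ «T2Shape» ∕ «T2Drift» ∕ (hW, hWall) ∕ D1;
NOT «D1 closed»; NEVER «G-an2-4 closed» as (CONV-C); NOT D1, NOT `BetaPertH`, NOT continuum, NOT Clay.  2026-08-22; no existing file touched.
-/


noncomputable section

open Finset
open scoped BigOperators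
open Literature.MathematicalPhysics.QuantumFieldTheory.Balaban1983to89
open Literature.MathematicalPhysics.QuantumFieldTheory.Balaban1983to89.Beta
open B6BondElimination (unitVec unitVec_apply)
open PlaquetteStencilData (WilsonIdx RemIdx wα wβ wm fam trm dim bsm rmm dvm dvβ rmα rmβ bsα bsβ boff bd₁ bd₂ bsgn diα diβ trα trβ faα faβ)
open PlaquetteStencil (dirBlock dirBlock_apply)
open GhostTable (curM copies curα curβ)
open SpinTable (spM spα spinMat spinMat_apply spinDir spinDir_apply)
open PlaquetteWeitzenbock (sTot)
open StepJetData (wilsonA wilsonA_translate)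
open BalabanStepJets (box1)
open ExpKernelCalculus (shiftK)
open Summit.QuantumFields.BalabanUV.Beta.GAN24.WilsonVertexSumZero (uv wc)
open Summit.QuantumFields.BalabanUV.Beta.GAN24.WilsonGradedBlockSums (dirBlock_one_apply copies_one_apply spinMat_one_apply wα_cur wβ_cur wc_cur
  wα_spin wβ_spin wc_spin wα_div wβ_div wc_div wα_di wβ_di wc_di wα_tr wβ_tr wc_tr wα_fa wβ_fa wc_fa)
open Summit.QuantumFields.BalabanUV.Beta.GAN24.WilsonFaceGradedIdentity (sum_weighted_wilsonA suppW_zero_subset_box1)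


namespace Summit.QuantumFields.BalabanUV.Beta.GAN24.WilsonEdgeCurrentDiag

variable {d : ℕ}

/-! ## §1 The two same-axis biweighted stencil sums, family by family (`α = γ`) -/

section DiagFam

variable (γ : Fin (d + 1)) (p q : ℤ → ℝ) (b : Fin (d + 1))

/-- [folklore] (H1, diagonal), current family: `[b = γ]·(p 0·q 1 − p(−1)·q(−1))`. -/
theorem h1d_cur : ∑ c : Bool, p (-(wβ uv γ (Sum.inl (Sum.inl (Sum.inl c)) : WilsonIdx (Fin (d + 1))) γ)) *
    q ((wα uv γ (Sum.inl (Sum.inl (Sum.inl c)) : WilsonIdx (Fin (d + 1))) γ) - (wβ uv γ (Sum.inl (Sum.inl (Sum.inl c)) : WilsonIdx (Fin (d + 1))) γ)) *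
    wc γ (Sum.inl (Sum.inl (Sum.inl c))) γ b = if b = γ then p 0 * q 1 - p (-1) * q (-1) else 0 := by
  rw [Fintype.sum_bool]
  simp only [wα_cur, wβ_cur, wc_cur, if_true, Bool.false_eq_true, if_false, Pi.zero_apply, neg_zero, sub_zero, uv, unitVec_apply]
  by_cases hb : b = γ
  · subst hb; simp
    ring
  · simp [hb, Ne.symm hb]

/-- [folklore] (H1, diagonal), spin family: `0`. -/
theorem h1d_spin : ∑ pr : Fin (d + 1) × Bool, p (-(wβ uv γ (Sum.inl (Sum.inl (Sum.inr pr)) : WilsonIdx (Fin (d + 1))) γ)) *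
    q ((wα uv γ (Sum.inl (Sum.inl (Sum.inr pr)) : WilsonIdx (Fin (d + 1))) γ) - (wβ uv γ (Sum.inl (Sum.inl (Sum.inr pr)) : WilsonIdx (Fin (d + 1))) γ)) *
    wc γ (Sum.inl (Sum.inl (Sum.inr pr))) γ b = 0 := by
  rw [Fintype.sum_prod_type]
  refine Finset.sum_eq_zero fun ν _ => ?_
  rw [Fintype.sum_bool]
  simp only [wα_spin, wβ_spin, wc_spin, sub_self]
  by_cases hν : ν = γ
  · subst hν
    simp [uv, unitVec_apply]
  · simp [uv, unitVec_apply, Ne.symm hν]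

/-- [folklore] (H1, diagonal), longitudinal family: `[b = γ]·2·(p(−1)·q(−1) − p 0·q 0)`. -/
theorem h1d_div : ∑ pr : Fin (d + 1) × Bool, p (-(wβ uv γ (Sum.inl (Sum.inr pr) : WilsonIdx (Fin (d + 1))) γ)) *
    q ((wα uv γ (Sum.inl (Sum.inr pr) : WilsonIdx (Fin (d + 1))) γ) - (wβ uv γ (Sum.inl (Sum.inr pr) : WilsonIdx (Fin (d + 1))) γ)) *
    wc γ (Sum.inl (Sum.inr pr)) γ b = if b = γ then 2 * (p (-1) * q (-1) - p 0 * q 0) else 0 := by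
  rw [Fintype.sum_prod_type]
  rw [Finset.sum_eq_single_of_mem γ (Finset.mem_univ γ)]
  · rw [Fintype.sum_bool]
    simp only [wα_div, wβ_div, wc_div, if_true, Bool.false_eq_true, if_false, Pi.zero_apply, Pi.sub_apply, uv, unitVec_apply]
    by_cases hb : b = γ
    · subst hb; simp
      ring
    · simp [hb]
  · intro ν _ hν
    rw [Fintype.sum_bool]
    simp [wα_div, wβ_div, wc_div, uv, unitVec_apply, Ne.symm hν]
    split_ifs <;> ring

/-- [folklore] (H1, diagonal), difference family: `0`. -/
theorem h1d_di : ∑ pr : Fin (d + 1) × (Fin 4 × Fin 12), p (-(wβ uv γ (Sum.inr (Sum.inl (Sum.inl pr)) : WilsonIdx (Fin (d + 1))) γ)) *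
    q ((wα uv γ (Sum.inr (Sum.inl (Sum.inl pr)) : WilsonIdx (Fin (d + 1))) γ) - (wβ uv γ (Sum.inr (Sum.inl (Sum.inl pr)) : WilsonIdx (Fin (d + 1))) γ)) *
    wc γ (Sum.inr (Sum.inl (Sum.inl pr))) γ b = 0 := by
  rw [Fintype.sum_prod_type]
  refine Finset.sum_eq_zero fun ν _ => ?_
  rw [Fintype.sum_prod_type]
  simp only [Fin.sum_univ_succ, Fin.sum_univ_zero, wα_di, wβ_di, wc_di, bd₁, bd₂, bsgn, boff, diα, diβ, dim, Matrix.cons_val_zero,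
    Matrix.cons_val_succ, Matrix.smul_apply, Matrix.neg_apply, Pi.add_apply, Pi.neg_apply, Pi.zero_apply, dirBlock_one_apply,
    uv, unitVec_apply, smul_eq_mul]
  by_cases hν : ν = γ
  · subst hν
    simp
    split_ifs <;> ring
  · simp [Ne.symm hν]
    ring

/-- [folklore] (H1, diagonal), transport family: `0`. -/
theorem h1d_tr : ∑ pr : Fin (d + 1) × (Fin 4 × Fin 8), p (-(wβ uv γ (Sum.inr (Sum.inl (Sum.inr pr)) : WilsonIdx (Fin (d + 1))) γ)) *
    q ((wα uv γ (Sum.inr (Sum.inl (Sum.inr pr)) : WilsonIdx (Fin (d + 1))) γ) - (wβ uv γ (Sum.inr (Sum.inl (Sum.inr pr)) : WilsonIdx (Fin (d + 1))) γ)) *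
    wc γ (Sum.inr (Sum.inl (Sum.inr pr))) γ b = 0 := by
  rw [Fintype.sum_prod_type]
  refine Finset.sum_eq_zero fun ν _ => ?_
  rw [Fintype.sum_prod_type]
  simp only [Fin.sum_univ_succ, Fin.sum_univ_zero, wα_tr, wβ_tr, wc_tr, bd₁, bd₂, bsgn, boff, trα, trβ, trm, Matrix.cons_val_zero,
    Matrix.cons_val_succ, Matrix.neg_apply, Pi.add_apply, Pi.neg_apply, Pi.zero_apply, dirBlock_one_apply, uv, unitVec_apply]
  by_cases hν : ν = γ
  · subst hν
    simp
  · simp [Ne.symm hν]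
    ring

/-- [folklore] (H1, diagonal), far-corner family: `0`. -/
theorem h1d_fa : ∑ pr : Fin (d + 1) × (Fin 4 × Bool), p (-(wβ uv γ (Sum.inr (Sum.inr pr) : WilsonIdx (Fin (d + 1))) γ)) *
    q ((wα uv γ (Sum.inr (Sum.inr pr) : WilsonIdx (Fin (d + 1))) γ) - (wβ uv γ (Sum.inr (Sum.inr pr) : WilsonIdx (Fin (d + 1))) γ)) *
    wc γ (Sum.inr (Sum.inr pr)) γ b = 0 := by
  rw [Fintype.sum_prod_type]
  refine Finset.sum_eq_zero fun ν _ => ?_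
  rw [Fintype.sum_prod_type]
  simp only [Fin.sum_univ_succ, Fin.sum_univ_zero, Fintype.sum_bool, wα_fa, wβ_fa, wc_fa, bd₁, bd₂, bsgn, boff, faα, faβ, fam,
    Matrix.cons_val_zero, Matrix.cons_val_succ, Matrix.neg_apply, Pi.add_apply, Pi.neg_apply, Pi.zero_apply, dirBlock_one_apply, uv,
    unitVec_apply, if_true, Bool.false_eq_true, if_false]
  by_cases hν : ν = γ
  · subst hν
    simp
    split_ifs <;> ring
  · simp [Ne.symm hν]
    split_ifs <;> ring

/-- [folklore] **(H1, diagonal) TOTAL**: `[b = γ]·(p(−1)·q(−1) + p 0·q 1 − 2·p 0·q 0)`. -/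
theorem h1d_total : ∑ i : WilsonIdx (Fin (d + 1)), p (-(wβ uv γ i γ)) * q ((wα uv γ i) γ - (wβ uv γ i) γ) * wc γ i γ b =
    if b = γ then p (-1) * q (-1) + p 0 * q 1 - 2 * (p 0 * q 0) else 0 := by
  rw [Fintype.sum_sum_type, Fintype.sum_sum_type, Fintype.sum_sum_type, Fintype.sum_sum_type, Fintype.sum_sum_type,
    h1d_cur γ p q b, h1d_spin γ p q b, h1d_div γ p q b, h1d_di γ p q b, h1d_tr γ p q b, h1d_fa γ p q b]
  split_ifs <;> ring

/-- [folklore] (H2, diagonal), current family: `[b = γ]·(p(−1)·q(−1) − p 0·q 1)`. -/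
theorem h2d_cur : ∑ c : Bool, p (-(wα uv γ (Sum.inl (Sum.inl (Sum.inl c)) : WilsonIdx (Fin (d + 1))) γ)) *
    q ((wβ uv γ (Sum.inl (Sum.inl (Sum.inl c)) : WilsonIdx (Fin (d + 1))) γ) - (wα uv γ (Sum.inl (Sum.inl (Sum.inl c)) : WilsonIdx (Fin (d + 1))) γ)) *
    wc γ (Sum.inl (Sum.inl (Sum.inl c))) b γ = if b = γ then p (-1) * q (-1) - p 0 * q 1 else 0 := by
  rw [Fintype.sum_bool]
  simp only [wα_cur, wβ_cur, wc_cur, if_true, Bool.false_eq_true, if_false, Pi.zero_apply, neg_zero, sub_zero, uv, unitVec_apply]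
  by_cases hb : b = γ
  · subst hb; simp
    ring
  · simp [hb]

/-- [folklore] (H2, diagonal), spin family: `0`. -/
theorem h2d_spin : ∑ pr : Fin (d + 1) × Bool, p (-(wα uv γ (Sum.inl (Sum.inl (Sum.inr pr)) : WilsonIdx (Fin (d + 1))) γ)) *
    q ((wβ uv γ (Sum.inl (Sum.inl (Sum.inr pr)) : WilsonIdx (Fin (d + 1))) γ) - (wα uv γ (Sum.inl (Sum.inl (Sum.inr pr)) : WilsonIdx (Fin (d + 1))) γ)) *
    wc γ (Sum.inl (Sum.inl (Sum.inr pr))) b γ = 0 := by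
  rw [Fintype.sum_prod_type]
  refine Finset.sum_eq_zero fun ν _ => ?_
  rw [Fintype.sum_bool]
  simp only [wα_spin, wβ_spin, wc_spin, sub_self]
  by_cases hν : ν = γ
  · subst hν
    simp [uv, unitVec_apply]
  · simp [uv, unitVec_apply, Ne.symm hν]

/-- [folklore] (H2, diagonal), longitudinal family: `[b = γ]·2·(p 0·q 1 − p 0·q 0)`. -/
theorem h2d_div : ∑ pr : Fin (d + 1) × Bool, p (-(wα uv γ (Sum.inl (Sum.inr pr) : WilsonIdx (Fin (d + 1))) γ)) *
    q ((wβ uv γ (Sum.inl (Sum.inr pr) : WilsonIdx (Fin (d + 1))) γ) - (wα uv γ (Sum.inl (Sum.inr pr) : WilsonIdx (Fin (d + 1))) γ)) *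
    wc γ (Sum.inl (Sum.inr pr)) b γ = if b = γ then 2 * (p 0 * q 1 - p 0 * q 0) else 0 := by
  rw [Fintype.sum_prod_type]
  rw [Finset.sum_eq_single_of_mem γ (Finset.mem_univ γ)]
  · rw [Fintype.sum_bool]
    simp only [wα_div, wβ_div, wc_div, if_true, Bool.false_eq_true, if_false, Pi.zero_apply, Pi.sub_apply, neg_zero, sub_zero, uv, unitVec_apply,
      and_true]
    by_cases hb : b = γ
    · subst hb; simp
      ring
    · simp [hb]
  · intro ν _ hν
    rw [Fintype.sum_bool]
    simp only [wc_div]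
    simp [Ne.symm hν]

/-- [folklore] (H2, diagonal), difference family: `0`. -/
theorem h2d_di : ∑ pr : Fin (d + 1) × (Fin 4 × Fin 12), p (-(wα uv γ (Sum.inr (Sum.inl (Sum.inl pr)) : WilsonIdx (Fin (d + 1))) γ)) *
    q ((wβ uv γ (Sum.inr (Sum.inl (Sum.inl pr)) : WilsonIdx (Fin (d + 1))) γ) - (wα uv γ (Sum.inr (Sum.inl (Sum.inl pr)) : WilsonIdx (Fin (d + 1))) γ)) *
    wc γ (Sum.inr (Sum.inl (Sum.inl pr))) b γ = 0 := by
  rw [Fintype.sum_prod_type]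
  refine Finset.sum_eq_zero fun ν _ => ?_
  rw [Fintype.sum_prod_type]
  simp only [Fin.sum_univ_succ, Fin.sum_univ_zero, wα_di, wβ_di, wc_di, bd₁, bd₂, bsgn, boff, diα, diβ, dim, Matrix.cons_val_zero,
    Matrix.cons_val_succ, Matrix.smul_apply, Matrix.neg_apply, Pi.add_apply, Pi.neg_apply, Pi.zero_apply, dirBlock_one_apply,
    uv, unitVec_apply, smul_eq_mul]
  by_cases hν : ν = γ
  · subst hν
    simp
    split_ifs <;> ring
  · simp [Ne.symm hν]

/-- [folklore] (H2, diagonal), transport family: `0`. -/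
theorem h2d_tr : ∑ pr : Fin (d + 1) × (Fin 4 × Fin 8), p (-(wα uv γ (Sum.inr (Sum.inl (Sum.inr pr)) : WilsonIdx (Fin (d + 1))) γ)) *
    q ((wβ uv γ (Sum.inr (Sum.inl (Sum.inr pr)) : WilsonIdx (Fin (d + 1))) γ) - (wα uv γ (Sum.inr (Sum.inl (Sum.inr pr)) : WilsonIdx (Fin (d + 1))) γ)) *
    wc γ (Sum.inr (Sum.inl (Sum.inr pr))) b γ = 0 := by
  rw [Fintype.sum_prod_type]
  refine Finset.sum_eq_zero fun ν _ => ?_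
  rw [Fintype.sum_prod_type]
  simp only [Fin.sum_univ_succ, Fin.sum_univ_zero, wα_tr, wβ_tr, wc_tr, bd₁, bd₂, bsgn, boff, trα, trβ, trm, Matrix.cons_val_zero,
    Matrix.cons_val_succ, Matrix.neg_apply, Pi.add_apply, Pi.neg_apply, Pi.zero_apply, dirBlock_one_apply, uv, unitVec_apply]
  by_cases hν : ν = γ
  · subst hν
    simp
  · simp [Ne.symm hν]

/-- [folklore] (H2, diagonal), far-corner family: `0`. -/
theorem h2d_fa : ∑ pr : Fin (d + 1) × (Fin 4 × Bool), p (-(wα uv γ (Sum.inr (Sum.inr pr) : WilsonIdx (Fin (d + 1))) γ)) *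
    q ((wβ uv γ (Sum.inr (Sum.inr pr) : WilsonIdx (Fin (d + 1))) γ) - (wα uv γ (Sum.inr (Sum.inr pr) : WilsonIdx (Fin (d + 1))) γ)) *
    wc γ (Sum.inr (Sum.inr pr)) b γ = 0 := by
  rw [Fintype.sum_prod_type]
  refine Finset.sum_eq_zero fun ν _ => ?_
  rw [Fintype.sum_prod_type]
  simp only [Fin.sum_univ_succ, Fin.sum_univ_zero, Fintype.sum_bool, wα_fa, wβ_fa, wc_fa, bd₁, bd₂, bsgn, boff, faα, faβ, fam,
    Matrix.cons_val_zero, Matrix.cons_val_succ, Matrix.neg_apply, Pi.add_apply, Pi.neg_apply, Pi.zero_apply, dirBlock_one_apply, uv,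
    unitVec_apply, if_true, Bool.false_eq_true, if_false]
  by_cases hν : ν = γ
  · subst hν
    simp
    split_ifs <;> ring
  · simp [Ne.symm hν]
    split_ifs <;> ring

/-- [folklore] **(H2, diagonal) TOTAL**: the SAME value `[b = γ]·(p(−1)·q(−1) + p 0·q 1 − 2·p 0·q 0)` as (H1, diagonal). -/
theorem h2d_total : ∑ i : WilsonIdx (Fin (d + 1)), p (-(wα uv γ i γ)) * q ((wβ uv γ i) γ - (wα uv γ i) γ) * wc γ i b γ =
    if b = γ then p (-1) * q (-1) + p 0 * q 1 - 2 * (p 0 * q 0) else 0 := by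
  rw [Fintype.sum_sum_type, Fintype.sum_sum_type, Fintype.sum_sum_type, Fintype.sum_sum_type, Fintype.sum_sum_type,
    h2d_cur γ p q b, h2d_spin γ p q b, h2d_div γ p q b, h2d_di γ p q b, h2d_tr γ p q b, h2d_fa γ p q b]
  split_ifs <;> ring

end DiagFam

/-! ## §2 The same-axis biweighted box sum VANISHES -/

section DiagCurrent

variable (γ : Fin (d + 1))

/-- [folklore] **THE SAME-AXIS BIWEIGHTED CONTRACTION OF THE CUBIC WILSON TABLE VANISHES** (slot at `0`; generic `d`; every `p q : ℤ → ℝ`; every second-leg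
component `b`): with the slot weighted by `p` of (minus) the second leg's `γ`-offset and the first leg ALSO along `γ`, weighted by `q` of its `γ`-offset
difference, `Σ_{x,z ∈ box1} p(−z_γ)·q(x_γ − z_γ)·wilsonA d γ 0 x z (inl γ) (inl b) = 0` — the two stencil sums (H1, diagonal) and (H2, diagonal) coincide
(current and longitudinal families cancel crosswise), so their antisymmetrisation is zero: a background along `γ` contracted with a leg along `γ` sources NO current. -/
theorem sum_box1_biweighted_wilsonA_diag (p q : ℤ → ℝ) (b : Fin (d + 1)) :
    ∑ x ∈ box1 (d + 1), ∑ z ∈ box1 (d + 1), p (-(z γ)) * q (x γ - z γ) * wilsonA d γ 0 x z (Sum.inl γ) (Sum.inl b) = 0 := by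
  have h := sum_weighted_wilsonA γ 0 γ b (box1 (d + 1)) (suppW_zero_subset_box1 γ) (fun x z => p (-(z γ)) * q (x γ - z γ))
  simp only [zero_add] at h
  rw [h, h1d_total γ p q b, h2d_total γ p q b]
  ring

/-- [folklore] **THE SAME WITH THE SECOND LEG AT A GENERAL SITE `z`**: for all `p q : ℤ → ℝ`, every `b` and every `z`,
`Σ_{x,w ∈ box1} p((z−w)_γ)·q((z−w+x)_γ)·wilsonA d γ (z−w) (z−w+x) z (inl γ) (inl b) = 0`. -/
theorem sum_box1_biweighted_wilsonA_diag_at (p q : ℤ → ℝ) (b : Fin (d + 1)) (z : Fin (d + 1) → ℤ) :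
    ∑ x ∈ box1 (d + 1), ∑ w ∈ box1 (d + 1), p ((z - w) γ) * q ((z - w + x) γ) * wilsonA d γ (z - w) (z - w + x) z (Sum.inl γ) (Sum.inl b) = 0 := by
  have key := sum_box1_biweighted_wilsonA_diag γ (fun t => p (z γ + t)) (fun t => q (z γ + t)) b
  have e : ∀ x w : Fin (d + 1) → ℤ,
      wilsonA d γ (z - w) (z - w + x) z (Sum.inl γ) (Sum.inl b) = wilsonA d γ 0 x w (Sum.inl γ) (Sum.inl b) := by
    intro x w
    have h := wilsonA_translate (d := d) γ 0 (z - w)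
    rw [zero_add] at h
    rw [h]
    show wilsonA d γ 0 (z - w + x + -(z - w)) (z + -(z - w)) (Sum.inl γ) (Sum.inl b) = _
    congr 1
    · abel
    · abel
  have ep : ∀ x w : Fin (d + 1) → ℤ, p ((z - w) γ) * q ((z - w + x) γ) = p (z γ + -(w γ)) * q (z γ + (x γ - w γ)) := by
    intro x w
    simp only [Pi.sub_apply, Pi.add_apply]
    rw [show z γ - w γ + x γ = z γ + (x γ - w γ) by ring, show z γ - w γ = z γ + -(w γ) from sub_eq_add_neg _ _]
  simp_rw [e, ep]
  exact key

end DiagCurrent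

end Summit.QuantumFields.BalabanUV.Beta.GAN24.WilsonEdgeCurrentDiag

end
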